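import Summits.QuantumFields.QCD.Theses.QuarksAsStableAction

/-!
# `WilsonQuarkStability` implies the STABLE MAJORANT of the antiperiodic Wilson-quark determinant
(crux `QuarksAsStableAction.StableActionBridge`, item stmt-QuantumFields-9737, line `Sketch`; lead helper,
`--supports stmt-QuantumFields-9737`)

The route's stability crux S = `WilsonQuarkStability` bounds `|det D_AP[U, m]|` by
`exp(K + c₂·S_good(U) + C·N_bad(U)) · |det D_AP[𝟙, m]|`, where `S_good` is the Wilson action of the `δ`-good
plaquettes and `N_bad` the number of `δ`-bad ones.  Since every bad plaquette has deficit `≥ δ`,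
`N_bad · δ ≤ S_bad`, and `S_good + S_bad = S_W(U)` is the full Wilson action (`wilsonAction (fundamentalRep (Fin 3)) U`,
literally the sum of the deficits `3 − Re tr U_p`), so S yields the simpler one-constant domination

  `|det D_AP[U, m]| ≤ exp(K + c · S_W(U)) · |det D_AP[𝟙, m]|`,   `c := max c₂ 0 + max C 0 / δ`,

uniformly in the volume and in `|m| ≤ ε` (`stableMajorant_of_wilsonQuarkStability`).  This is the `j = 0` anchor by
which the bridge consumes S at the bare scale (cards `sylvester-defect-floor` §First lemma (3), `pauli-freezing`
§Why it bites here): the quark weight of ANY configuration is dominated by the free antiperiodic determinant times a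
positive multiple of the Wilson action — "quarks are a stable action".  Elementary bookkeeping over the
good/bad splitting of `Finset.univ : Finset (Plaquette 4 L)`; no analysis.
-/

namespace Summit.QuantumFields.QCD.Cruxes.StableActionBridge.Sketch

open Literature.MathematicalPhysics.QuantumLattice Literature.MathematicalPhysics.QuantumFieldTheory
open Summit.QuantumFields.QCD.Theses.QuarksAsStableAction (WilsonQuarkStability)

/-- `Re tr U ≤ 3` for `U ∈ SU(3)` in the fundamental representation (unitary entries have modulus `≤ 1`). -/
private theorem re_trace_rho3_le_three (g : Matrix.specialUnitaryGroup (Fin 3) ℂ) :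
    ((fundamentalRep (Fin 3)) g).trace.re ≤ 3 := by
  have hU := fundamentalRep_mem_unitaryGroup g
  rw [Matrix.trace, Complex.re_sum]
  calc ∑ a, (Matrix.diag ((fundamentalRep (Fin 3)) g) a).re
      ≤ ∑ _a : Fin 3, (1 : ℝ) := Finset.sum_le_sum fun a _ =>
        ((le_abs_self _).trans (Complex.abs_re_le_norm _)).trans (entry_norm_bound_of_unitary hU a a)
    _ = 3 := by simp

/-- Bookkeeping over a good/bad splitting: if `0 ≤ f p` for all `p` and `δ ≤ f p` on the bad set, then
`c₂ · Σ_good f + C · #bad ≤ (max c₂ 0 + max C 0 / δ) · Σ_all f` for `δ > 0`. -/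
private theorem good_bad_budget {ι : Type*} (s : Finset ι) (f : ι → ℝ) (δ c₂ C : ℝ) (hδ : 0 < δ)
    (hf : ∀ p ∈ s, 0 ≤ f p) :
    c₂ * (∑ p ∈ s.filter (fun p => f p < δ), f p) + C * ((s.filter (fun p => δ ≤ f p)).card : ℝ) ≤
      (max c₂ 0 + max C 0 / δ) * ∑ p ∈ s, f p := by
  set good := s.filter (fun p => f p < δ) with hgood
  set bad := s.filter (fun p => δ ≤ f p) with hbad
  have hsplit : ∑ p ∈ s, f p = (∑ p ∈ good, f p) + ∑ p ∈ bad, f p := by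
    rw [hgood, hbad, ← Finset.sum_filter_add_sum_filter_not s (fun p => f p < δ)]
    congr 1
    refine Finset.sum_congr ?_ fun _ _ => rfl
    ext p
    simp only [Finset.mem_filter, not_lt]
  have hgood_nonneg : 0 ≤ ∑ p ∈ good, f p :=
    Finset.sum_nonneg fun p hp => hf p (Finset.mem_filter.1 hp).1
  have hbad_nonneg : 0 ≤ ∑ p ∈ bad, f p :=
    Finset.sum_nonneg fun p hp => hf p (Finset.mem_filter.1 hp).1
  have hcard : (bad.card : ℝ) * δ ≤ ∑ p ∈ bad, f p := by
    have h := Finset.card_nsmul_le_sum bad f δ fun p hp => (Finset.mem_filter.1 hp).2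
    simpa [nsmul_eq_mul] using h
  have hcard' : (bad.card : ℝ) ≤ (∑ p ∈ bad, f p) / δ := by
    rw [le_div_iff₀ hδ]; exact hcard
  have h1 : c₂ * ∑ p ∈ good, f p ≤ max c₂ 0 * ∑ p ∈ good, f p :=
    mul_le_mul_of_nonneg_right (le_max_left _ _) hgood_nonneg
  have h2 : C * (bad.card : ℝ) ≤ max C 0 * ((∑ p ∈ bad, f p) / δ) :=
    (mul_le_mul_of_nonneg_right (le_max_left C 0) (Nat.cast_nonneg _)).trans
      (mul_le_mul_of_nonneg_left hcard' (le_max_right _ _))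
  have h3 : max c₂ 0 * ∑ p ∈ good, f p ≤ max c₂ 0 * ∑ p ∈ s, f p :=
    mul_le_mul_of_nonneg_left (by rw [hsplit]; linarith) (le_max_right _ _)
  have h4 : max C 0 * ((∑ p ∈ bad, f p) / δ) ≤ max C 0 / δ * ∑ p ∈ s, f p := by
    rw [div_mul_eq_mul_div, mul_div_assoc]
    exact mul_le_mul_of_nonneg_left (div_le_div_of_nonneg_right (by rw [hsplit]; linarith) hδ.le)
      (le_max_right _ _)
  calc c₂ * (∑ p ∈ good, f p) + C * (bad.card : ℝ)
      ≤ max c₂ 0 * ∑ p ∈ s, f p + max C 0 / δ * ∑ p ∈ s, f p := add_le_add (h1.trans h3) (h2.trans h4)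
    _ = (max c₂ 0 + max C 0 / δ) * ∑ p ∈ s, f p := by ring

/-- **Stable majorant from stability** (`WilsonQuarkStability → StableMajorant`): if the antiperiodic
Wilson-quark determinant obeys the route's stability bound S with constants `ε, δ, K, c₂, C, L₀`, then with
`c := max c₂ 0 + max C 0 / δ` it obeys, for all `L ≥ L₀`, `|m| ≤ ε` and every `SU(3)` gauge field `U`,
`|det D_AP[U, m]| ≤ exp(K + c · S_W(U)) · |det D_AP[𝟙, m]|` with `S_W = wilsonAction (fundamentalRep (Fin 3))`
the full Wilson action — because `N_bad · δ ≤ S_bad` and `S_good + S_bad = S_W`.  CONDITIONAL on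
`WilsonQuarkStability` (item stmt-QuantumFields-9736, open), taken as the hypothesis. -/
theorem stableMajorant_of_wilsonQuarkStability :
    WilsonQuarkStability → ∃ ε c K : ℝ, 0 < ε ∧ ∃ L₀ : ℕ, ∀ (L : ℕ) [NeZero L], L₀ ≤ L →
      let apDet : GaugeConfig 4 L (Matrix.specialUnitaryGroup (Fin 3) ℂ) → ℝ → ℂ := fun U m =>
        fermionDet (wilsonDirac (unitaryFundamentalRep (Fin 3) ℂ)
          (fun e => if e.1 e.2 = -1
            then -(⟨(U e).1, Matrix.specialUnitaryGroup_le_unitaryGroup (U e).2⟩ :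
              Matrix.unitaryGroup (Fin 3) ℂ)
            else ⟨(U e).1, Matrix.specialUnitaryGroup_le_unitaryGroup (U e).2⟩) m 1);
      ∀ m : ℝ, |m| ≤ ε → ∀ U : GaugeConfig 4 L (Matrix.specialUnitaryGroup (Fin 3) ℂ),
        ‖apDet U m‖ ≤ Real.exp (K + c * wilsonAction (fundamentalRep (Fin 3)) U) * ‖apDet 1 m‖ := by
  intro hS
  obtain ⟨ε, δ, K, c₂, C, hε, hδ, L₀, h⟩ := hS
  refine ⟨ε, max c₂ 0 + max C 0 / δ, K, hε, L₀, fun L _ hL => ?_⟩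
  intro apDet m hm U
  have hmain := h L hL m hm U
  -- the route's deficit function and the Wilson action are the same sum of deficits
  set dfc : GaugeConfig 4 L (Matrix.specialUnitaryGroup (Fin 3) ℂ) → Plaquette 4 L → ℝ :=
    fun U p => 3 - ((fundamentalRep (Fin 3)) (plaquetteHolonomy U p.1 p.2.1.1 p.2.1.2)).trace.re with hdfc
  have hW : wilsonAction (fundamentalRep (Fin 3)) U = ∑ p, dfc U p := by
    simp only [wilsonAction, hdfc, Nat.cast_ofNat]
  have hnonneg : ∀ p ∈ (Finset.univ : Finset (Plaquette 4 L)), 0 ≤ dfc U p := fun p _ => by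
    simp only [hdfc, sub_nonneg]
    exact re_trace_rho3_le_three _
  have hbudget := good_bad_budget Finset.univ (dfc U) δ c₂ C hδ hnonneg
  refine hmain.trans (mul_le_mul_of_nonneg_right (Real.exp_le_exp.2 ?_) (norm_nonneg _))
  rw [hW, add_assoc]
  exact add_le_add le_rfl hbudget

end Summit.QuantumFields.QCD.Cruxes.StableActionBridge.Sketch
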